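import Literature.AnabelianGeometry.EtaleTheta.FrobenioidThetaOfBiKummerData
import Literature.AnabelianGeometry.EtaleTheta.FrobenioidRootTransport
import Literature.AlgebraicGeometry.Frobenioids.BaseSectionsOfObjectsUniquenessGeneral
import Literature.AlgebraicGeometry.Frobenioids.ModelFrobenioidNormalized

/-!
# [EtTh] Thm. 4.4 (iv) at the `N`-th root for the assembled §5 data: the transport `hstrv` of `s^trv_N` from [FrdI] Prop. 5.6 (pp. 320, 330–331, 334 / PDF pp. 94, 104–105, 108)

Mochizuki, *The étale theta function …*, Publ. RIMS **45** (2009): §5 p.330–331 (PDF pp.104–105) "the group homomorphism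
`s^trv_N : Aut_D(A_N^bs) → Aut_C(A_N)` … arising from a base-Frobenius pair of `A_N` [cf. Proposition 5.1; Theorem 3.7, (i);
[FrdI], Proposition 5.6], which is completely determined … up to conjugation by an element of `O^×(A_N)`"; Thm. 5.10 (ii) proof
p.334–335 (PDF pp.108–109) "`Ψ` preserves … the corresponding bi-Kummer `N`-th roots [cf. Theorem 4.4, (iv)]"
[cite: MochizukiEtTh2009, Thm 5.10 (ii) p.334 (PDF p.108)]; Mochizuki, *The geometry of Frobenioids I*, Kyushu J. Math. **62**
(2008), Prop. 5.6 p.105 [cite: MochizukiFrdI2008, Prop. 5.6 p.105].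

PROOF-ONLY (no definitions, no new named facts).  abc-iut cell, layer L2, row #2-R18 / RULINGS #6 (R52) (prover abc-iut-w5-d245),
GAP row G-w5d245-1: the LAST of the five transport binders of `ThetaFrobenioid.cyclotomicRigidityPreserved_ofBiKummerData`
(p421202), `hstrv : StrvTransport Ψ α e θ`.  The census (`Discharge/Sec5TransportsOfBiKummerData.lean`, p424854) found it NOT
derivable at `ofBiKummerData` for the free section parameter `σ`; print's `s^trv_N` is a base-Frobenius pair OF THE OBJECT `A_N`,
and for those [FrdI] Prop. 5.6 gives uniqueness up to conjugation by a unit.  This file proves exactly that route: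

* `PreFrobenioid.sectionPairs_conjugate` — [FrdI] Prop. 5.6 for ABSTRACT section pairs `(σ, φ)` at an object `A` of a Frobenioid
  of Frobenius-normalized type: `σ` a section of `Aut_C(A) → Aut_D(A^bs)`, `φ : ℕ_{≥1} → End_C(A)` with `φ(n)` base-identity of
  Frobenius type of degree `n`, and `σ(g) ∘ φ(n) = φ(n) ∘ σ(g)`; two such pairs are conjugate AS PAIRS by a unit `u ∈ O^×(A)`.
  The printed proof (in the 2024 form without "unit-profinite", abc-iut-L1-t12's `basePairs_conjugate_of_isFrobeniusNormalized`)
  uses the ambient base-Frobenius pair `(P, F)` ONLY through these three properties (`IsRestrictedPair.base_σ/.frobenius/.comm`),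
  so the same argument applies verbatim — adapted here, credit abc-iut-L1-t12 / abc-iut-L1-t5.
* `PreFrobenioid.exists_unit_conj_of_transportedSectionPair` — Thm. 4.4 (iv) / the first sentence of the proof of Thm. 5.10 (ii):
  for a self-equivalence `Ψ`, an identification `α : Ψ(A) ⥲ A` and the base shadow `θ` of `Ψ` at `A` (`Base(α⁻¹ Ψ(f) α) = θ(Base f)`
  on automorphisms), if `Ψ` read through `α` carries base-identity Frobenius-type endomorphisms of `A` to such (degrees moved by
  `Ψ^{ℕ≥1}`, [FrdI] Thm. 3.4 (iii)), then the TRANSPORTED pair `(α⁻¹ Ψ(σ(θ⁻¹ ·)) α, α⁻¹ Ψ(φ((Ψ^{ℕ≥1})⁻¹ ·)) α)` is again a section pair,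
  hence (Prop. 5.6) `α⁻¹ ≫ Ψ(σ g) ≫ α = u⁻¹ ≫ σ(θ g) ≫ u` for ONE unit `u` and all `g`.
* `ThetaFrobenioid.exists_unit_strvTransport_ofBiKummerData` — AT THE DATA `ofBiKummerData` (`s^trv_N := σ`, `autBaseIsoAB =`
  conjugation by `(s^⊓_N)^bs`): `∃ e ∈ O^×(A_N), StrvTransport Ψ α e θ_B` with `θ_B :=` the shadow `θ` read on `Aut_D(B_N^bs)` — i.e.
  the binder `hstrv` — from: `σ` extends to a section pair `(σ, φ)` («`s^trv_N` arises from a base-Frobenius pair of `A_N`»; e.g.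
  the restriction of any base-Frobenius pair `(P, F) ∋ A_N`, `IsRestrictedPair`), and the base shadow / Frobenius-transport
  clauses of `Ψ` at `A_N` — Frobenius-normalization being a THEOREM for the model (`ModelFrobenioid.isOfType_isFrobeniusNormalized`,
  abc-iut-L1) and "`C` is a Frobenioid" = [FrdI] Thm. 5.2 (ii) (`ModelFrobenioid.isFrobenioid` under `ModelFrobenioid.Hypotheses`) — (abc-iut-L2-d4's
  `exists_compatBase_of_model_slim` and abc-iut-L1's `FrdI.thm34iii_morphisms_of_isOfFSMType` supply them for the model; kept as
  named binders here, census in the docstrings).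

HONEST FRAMING: `e` is produced as a UNIT; its identification with the divisor-matching `e` of `hT`/`hT′` (the SAME `e` in p421202)
is the next sentence of Thm. 5.10 (ii)'s proof and is NOT claimed here (G-w5d245-1 disposition row).  Nothing asserts that the §5 data
exist for an actual curve; no side is taken on [IUTchIII] Cor. 3.12.
-/

noncomputable section

open CategoryTheory

/-! ### [FrdI] Prop. 5.6 for abstract section pairs -/

namespace Literature.AlgebraicGeometry.Frobenioids

namespace PreFrobenioid

universe w v v' u u'

variable {D : Type u} [Category.{v} D] {Φ : Dᵒᵖ ⥤ CommMonCat.{w}}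
  {C : Type u'} [Category.{v'} C] (F : C ⥤ ElemFrobenioid Φ)

/-- **[FrdI] Prop. 5.6 for abstract section pairs** (the printed proof, pp.106–107, in the 2024 form of the author's Comments
item (2); it uses the ambient base-Frobenius pairs only through the three displayed properties).  For a Frobenioid of
Frobenius-normalized type and an object `A`: if `(σ, φ)`, `(σ', φ')` are pairs with `σ, σ'` sections of
`Aut_C(A) → Aut_D(A^bs)`, `φ(n), φ'(n)` base-identity endomorphisms of Frobenius type of degree `n`, and `σ(g)` commuting with
`φ(n)` (resp. `σ'(g)` with `φ'(n)`), then `(σ', φ') = u⁻¹ (σ, φ) u` for a unit `u ∈ O^×(A)`.  Adapted from abc-iut-L1-t12's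
`basePairs_conjugate_of_isFrobeniusNormalized`. [cite: MochizukiFrdI2008, Prop. 5.6 p.105] -/
theorem sectionPairs_conjugate (hF : IsFrobenioid F) (hnorm : IsOfType (IsFrobeniusNormalized F)) {A : C}
    {σ σ' : Aut (baseObj F A) →* Aut A} {φ φ' : ℕ+ →* End A}
    (hσ : ∀ g : Aut (baseObj F A), (baseFunctor F).mapIso (σ g) = g)
    (hσ' : ∀ g : Aut (baseObj F A), (baseFunctor F).mapIso (σ' g) = g)
    (hφ : ∀ n : ℕ+, degFr F (End.asHom (φ n)) = n ∧ IsBaseIdentity F (End.asHom (φ n)) ∧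
      IsFrobeniusType F (End.asHom (φ n)))
    (hφ' : ∀ n : ℕ+, degFr F (End.asHom (φ' n)) = n ∧ IsBaseIdentity F (End.asHom (φ' n)) ∧
      IsFrobeniusType F (End.asHom (φ' n)))
    (hc : ∀ (n : ℕ+) (g : Aut (baseObj F A)), (σ g).hom ≫ End.asHom (φ n) = End.asHom (φ n) ≫ (σ g).hom)
    (hc' : ∀ (n : ℕ+) (g : Aut (baseObj F A)), (σ' g).hom ≫ End.asHom (φ' n) = End.asHom (φ' n) ≫ (σ' g).hom) :
    ∃ u ∈ unitsSubgroup F A, PairConjugate F u σ σ' φ φ' := by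
  classical
  have hepi : ∀ {X Y : C} (f : X ⟶ Y), Epi f := fun f => hF.isPreFrobenioid.isTotallyEpimorphic.epi f
  -- Step 1: the units `v n` with `φ' n = φ n ≫ v n`
  have hv : ∀ n : ℕ+, ∃ v ∈ unitsSubgroup F A, End.asHom (φ' n) = End.asHom (φ n) ≫ v.hom :=
    fun n => exists_unit_comp_eq F hF (hφ n).2.2 (hφ' n).2.2 (hφ n).2.1 (hφ' n).2.1
      ((hφ n).1.trans (hφ' n).1.symm)
  choose v hvmem hv using hv
  -- Frobenius-normalization: `w ≫ φ n = φ n ≫ w^n` for units `w`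
  have hnφ : ∀ (n : ℕ+) {w : Aut A}, w ∈ unitsSubgroup F A →
      w.hom ≫ End.asHom (φ n) = End.asHom (φ n) ≫ (w ^ ((n : ℕ+) : ℕ)).hom := by
    intro n w hw
    have := unit_comp_eq_comp_pow F (hnorm A) (hφ n).2.1 hw
    rwa [(hφ n).1] at this
  -- `φ`, `φ'` take commuting values
  have hcomm : ∀ (ψ : ℕ+ →* End A) (m n : ℕ+),
      End.asHom (ψ m) ≫ End.asHom (ψ n) = End.asHom (ψ n) ≫ End.asHom (ψ m) := by
    intro ψ m n
    have h1 : End.asHom (ψ (n * m)) = End.asHom (ψ m) ≫ End.asHom (ψ n) := by rw [map_mul]; rfl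
    have h2 : End.asHom (ψ (m * n)) = End.asHom (ψ n) ≫ End.asHom (ψ m) := by rw [map_mul]; rfl
    rw [← h1, ← h2, mul_comm]
  -- Step 2: the cocycle `v l₁ ^ (l₂ - 1) = v l₂ ^ (l₁ - 1)` in the commutative group `O^×(A)`
  letI : CommGroup (unitsSubgroup F A) := unitsCommGroup F hF A
  let vv : Nat.Primes → unitsSubgroup F A := fun l => ⟨v l, hvmem l⟩
  have hcocycle : ∀ l₁ l₂ : Nat.Primes,
      vv l₁ ^ ((l₂ : ℕ) - 1) = vv l₂ ^ ((l₁ : ℕ) - 1) := by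
    intro l₁ l₂
    have key : (v l₁ ^ ((l₂ : ℕ+) : ℕ)).hom ≫ (v l₂).hom =
        (v l₂ ^ ((l₁ : ℕ+) : ℕ)).hom ≫ (v l₁).hom := by
      have e := hcomm φ' l₁ l₂
      rw [hv l₁, hv l₂, Category.assoc, Category.assoc, reassoc_of% (hnφ l₂ (hvmem l₁)),
        reassoc_of% (hnφ l₁ (hvmem l₂)), reassoc_of% (hcomm φ l₂ l₁)] at e
      exact (cancel_epi _).mp ((cancel_epi _).mp e)
    have key' : v l₂ * v l₁ ^ ((l₂ : ℕ+) : ℕ) = v l₁ * v l₂ ^ ((l₁ : ℕ+) : ℕ) := by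
      ext
      rw [Aut.Aut_mul_def, Aut.Aut_mul_def, Iso.trans_hom, Iso.trans_hom]
      exact key
    have key'' : vv l₂ * vv l₁ ^ ((l₂ : ℕ+) : ℕ) = vv l₁ * vv l₂ ^ ((l₁ : ℕ+) : ℕ) :=
      Subtype.ext key'
    have h₁ : ((l₂ : ℕ+) : ℕ) = ((l₂ : ℕ) - 1) + 1 := (Nat.sub_add_cancel l₂.2.one_lt.le).symm
    have h₂ : ((l₁ : ℕ+) : ℕ) = ((l₁ : ℕ) - 1) + 1 := (Nat.sub_add_cancel l₁.2.one_lt.le).symm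
    rw [h₁, h₂, pow_succ, pow_succ] at key''
    have : vv l₁ * vv l₂ * vv l₁ ^ ((l₂ : ℕ) - 1) = vv l₁ * vv l₂ * vv l₂ ^ ((l₁ : ℕ) - 1) := by
      calc vv l₁ * vv l₂ * vv l₁ ^ ((l₂ : ℕ) - 1)
          = vv l₂ * (vv l₁ ^ ((l₂ : ℕ) - 1) * vv l₁) := by
            rw [mul_comm (vv l₁) (vv l₂), mul_assoc, mul_comm (vv l₁)]
        _ = vv l₁ * (vv l₂ ^ ((l₁ : ℕ) - 1) * vv l₂) := key''
        _ = vv l₁ * vv l₂ * vv l₂ ^ ((l₁ : ℕ) - 1) := by rw [mul_assoc, mul_comm (vv l₂ ^ _)]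
    exact mul_left_cancel this
  -- Step 3 (Comments (2024) item (2)): `u₀ := c_2`, `u := u₀⁻¹`
  let u₀ : unitsSubgroup F A := vv ⟨2, Nat.prime_two⟩
  have hu₀ : ∀ l : Nat.Primes, u₀ ^ ((l : ℕ) - 1) = vv l := fun l => by
    have h := hcocycle ⟨2, Nat.prime_two⟩ l
    have h2 : (((⟨2, Nat.prime_two⟩ : Nat.Primes) : ℕ) - 1) = 1 := rfl
    rw [h2, pow_one] at h
    exact h
  set uA : Aut A := ((u₀⁻¹ : unitsSubgroup F A) : Aut A) with huA
  have huAmem : uA ∈ unitsSubgroup F A := (u₀⁻¹).2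
  have huAinv : uA.inv = (u₀ : Aut A).hom := by
    rw [huA, Subgroup.coe_inv, Aut.Aut_inv_def, Iso.symm_inv]
  have huAhom : uA.hom = (u₀ : Aut A).inv := by
    rw [huA, Subgroup.coe_inv, Aut.Aut_inv_def, Iso.symm_hom]
  -- conjugation of `φ` at primes …
  have hprime : ∀ l : Nat.Primes,
      End.asHom (φ' l) = uA.inv ≫ End.asHom (φ l) ≫ uA.hom := by
    intro l
    have hU : ((vv l : unitsSubgroup F A) : Aut A) = (u₀ : Aut A) ^ ((l : ℕ) - 1) := by
      rw [← hu₀ l, Subgroup.coe_pow]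
    have hl1 : ((l : ℕ+) : ℕ) = ((l : ℕ) - 1) + 1 := (Nat.sub_add_cancel l.2.one_lt.le).symm
    have e1 : v (l : ℕ+) = (u₀ : Aut A)⁻¹ * (u₀ : Aut A) ^ ((l : ℕ+) : ℕ) := by
      rw [hl1, pow_succ', inv_mul_cancel_left, ← hU]
    have hvl : (v l).hom = ((u₀ : Aut A) ^ ((l : ℕ+) : ℕ)).hom ≫ (u₀ : Aut A).inv := by
      have e2 := congrArg Iso.hom e1
      rw [Aut.Aut_mul_def, Iso.trans_hom, Aut.Aut_inv_def, Iso.symm_hom] at e2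
      exact e2
    rw [hv l, hvl, huAinv, huAhom, ← Category.assoc (u₀ : Aut A).hom, hnφ l u₀.2, Category.assoc]
  -- … hence for all `n`
  let c : End A →* End A :=
    { toFun := fun x => End.of (uA.inv ≫ End.asHom x ≫ uA.hom)
      map_one' := by simp [End.one_def]
      map_mul' := fun x y => by simp [End.mul_def] }
  have hall : ∀ n : ℕ+, End.asHom (φ' n) = uA.inv ≫ End.asHom (φ n) ≫ uA.hom := by
    have heq : φ' = c.comp φ := pnat_monoidHom_ext fun p => hprime p
    intro n
    exact congrArg (fun ψ : ℕ+ →* End A => End.asHom (ψ n)) heq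
  refine ⟨uA, huAmem, fun α => ?_, fun n => hall n⟩
  -- Step 4: the section part `σ' α = uA.symm ≪≫ σ α ≪≫ uA`
  set τ : Aut A := uA.symm ≪≫ σ α ≪≫ uA with hτ
  set vα : Aut A := τ.symm ≪≫ σ' α with hvαdef
  have hσ'eq : σ' α = τ ≪≫ vα := by rw [hvαdef, Iso.self_symm_id_assoc]
  have hbu : Base F uA.hom = 𝟙 _ := huAmem.1
  have hbui : Base F uA.inv = 𝟙 _ := by
    have := ((unitsSubgroup F A).inv_mem huAmem).1
    rwa [Aut.Aut_inv_def] at this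
  have hbσ : Base F (σ α).inv = α.inv := congrArg Iso.inv (hσ α)
  have hbσ' : Base F (σ' α).hom = α.hom := congrArg Iso.hom (hσ' α)
  have hvα : vα ∈ unitsSubgroup F A := by
    refine ⟨?_, isLinear_of_isIso F _⟩
    show Base F (τ.inv ≫ (σ' α).hom) = 𝟙 _
    rw [hτ]
    simp only [Iso.trans_inv, Iso.symm_inv, base_comp, hbu, hbui, hbσ, hbσ', Category.assoc,
      Category.id_comp, Category.comp_id, Iso.inv_hom_id]
  have e := hc' 2 α
  have hs' : (σ' α).hom = uA.inv ≫ (σ α).hom ≫ uA.hom ≫ vα.hom := by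
    rw [hσ'eq, Iso.trans_hom, hτ, Iso.trans_hom, Iso.trans_hom, Iso.symm_hom, Category.assoc,
      Category.assoc]
  rw [hs', hall 2] at e
  simp only [Category.assoc] at e
  have hcw : uA.hom ≫ vα.hom = vα.hom ≫ uA.hom := units_hom_comm F hF huAmem hvα
  rw [reassoc_of% hcw, hcw, Iso.hom_inv_id_assoc, Iso.hom_inv_id_assoc,
    reassoc_of% (hnφ 2 hvα), reassoc_of% (hc 2 α)] at e
  have e3 : (vα ^ ((2 : ℕ+) : ℕ)).hom = vα.hom :=
    (cancel_mono uA.hom).mp ((cancel_epi (σ α).hom).mp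
      ((cancel_epi (End.asHom (φ 2))).mp ((cancel_epi uA.inv).mp e)))
  have hsq : vα ^ ((2 : ℕ+) : ℕ) = vα := Iso.ext e3
  have hv1 : vα = 1 := by
    have : vα * vα = vα * 1 := by rw [mul_one, ← pow_two]; exact hsq
    exact mul_left_cancel this
  rw [hσ'eq, hv1]
  exact Iso.trans_refl _

/-- The restriction `(σ, φ)` of a base-Frobenius pair `(P, F)` to `A ∈ Ob(P)` IS a section pair in the above sense
([FrdI] Prop. 5.6: "the pair determined by 'restricting' `P`, `F` to `A`"): section property, Frobenius clauses, and the
commutation `σ(g) ∘ φ(n) = φ(n) ∘ σ(g)` (functoriality of `F` on `P`). [cite: MochizukiFrdI2008, Prop. 5.6 p.105] -/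
theorem IsRestrictedPair.sectionPair {P : Presection C} {Fr : ℕ+ →* End P.ι} {A : C}
    {σ : Aut (baseObj F A) →* Aut A} {φ : ℕ+ →* End A} (hP : IsBaseFrobeniusPair F P Fr)
    (hr : IsRestrictedPair F P Fr A σ φ) :
    (∀ g : Aut (baseObj F A), (baseFunctor F).mapIso (σ g) = g) ∧
      (∀ n : ℕ+, degFr F (End.asHom (φ n)) = n ∧ IsBaseIdentity F (End.asHom (φ n)) ∧
        IsFrobeniusType F (End.asHom (φ n))) ∧
      ∀ (n : ℕ+) (g : Aut (baseObj F A)), (σ g).hom ≫ End.asHom (φ n) = End.asHom (φ n) ≫ (σ g).hom :=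
  ⟨hr.base_σ, fun n => hr.frobenius hP n, fun n g => hr.comm n g⟩

/-! ### Thm. 4.4 (iv): the transported section pair and the unit -/

/-- **The `Ψ`-transport of a section pair is a section pair, hence conjugate to the original by a unit** ([EtTh] Thm. 4.4
(iv) at the `N`-th root / the first step of the proof of Thm. 5.10 (ii), p.334 (PDF p.108), via [FrdI] Prop. 5.6): for a
self-equivalence `Ψ` of a Frobenioid of Frobenius-normalized type, `α : Ψ(A) ⥲ A`, the base shadow `θ` of `Ψ` at `A` through `α`
(`Base(α⁻¹ ≫ Ψ(f) ≫ α) = θ(Base f)` on `Aut_C(A)`), and `Ψ` read through `α` carrying base-identity endomorphisms to base-identity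
ones, Frobenius-type to Frobenius-type, with degrees moved by an automorphism `Ψ^{ℕ≥1}` of `ℕ_{≥1}` ([FrdI] Thm. 3.4 (iii)): every
section pair `(σ, φ)` at `A` satisfies `α⁻¹ ≫ Ψ(σ g) ≫ α = u⁻¹ ≫ σ(θ g) ≫ u` for one unit `u ∈ O^×(A)` and all `g ∈ Aut_D(A^bs)`.
[cite: MochizukiEtTh2009, Thm 5.10 (ii) p.334 (PDF p.108)] -/
theorem exists_unit_conj_of_transportedSectionPair (hF : IsFrobenioid F)
    (hnorm : IsOfType (IsFrobeniusNormalized F)) {A : C}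
    {σ : Aut (baseObj F A) →* Aut A} {φ : ℕ+ →* End A}
    (hσ : ∀ g : Aut (baseObj F A), (baseFunctor F).mapIso (σ g) = g)
    (hφ : ∀ n : ℕ+, degFr F (End.asHom (φ n)) = n ∧ IsBaseIdentity F (End.asHom (φ n)) ∧
      IsFrobeniusType F (End.asHom (φ n)))
    (hc : ∀ (n : ℕ+) (g : Aut (baseObj F A)), (σ g).hom ≫ End.asHom (φ n) = End.asHom (φ n) ≫ (σ g).hom)
    (Ψ : C ≌ C) (α : Ψ.functor.obj A ≅ A) (θ : Aut (baseObj F A) ≃* Aut (baseObj F A))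
    (hθ : ∀ f : Aut A, (baseFunctor F).mapIso (α.symm ≪≫ Ψ.functor.mapIso f ≪≫ α) = θ ((baseFunctor F).mapIso f))
    (ΨN : ℕ+ ≃* ℕ+) (hdeg : ∀ f : A ⟶ A, degFr F (α.inv ≫ Ψ.functor.map f ≫ α.hom) = ΨN (degFr F f))
    (hbi : ∀ f : A ⟶ A, IsBaseIdentity F f → IsBaseIdentity F (α.inv ≫ Ψ.functor.map f ≫ α.hom))
    (hft : ∀ f : A ⟶ A, IsFrobeniusType F f → IsFrobeniusType F (α.inv ≫ Ψ.functor.map f ≫ α.hom)) :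
    ∃ u ∈ unitsSubgroup F A, ∀ g : Aut (baseObj F A),
      α.inv ≫ Ψ.functor.map (σ g).hom ≫ α.hom = u.inv ≫ (σ (θ g)).hom ≫ u.hom := by
  -- the transported pair `(σ', φ')`
  let σ' : Aut (baseObj F A) →* Aut A :=
    (α.conjAut.toMonoidHom.comp ((Ψ.functor.mapAut A).comp σ)).comp θ.symm.toMonoidHom
  have hσ'_apply : ∀ g, σ' g = α.symm ≪≫ Ψ.functor.mapIso (σ (θ.symm g)) ≪≫ α := fun g => by
    change α.conjAut (Ψ.functor.mapIso (σ (θ.symm g))) = _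
    exact Iso.conjAut_apply _ _
  have hσ'_hom : ∀ g, (σ' g).hom = α.inv ≫ Ψ.functor.map (σ (θ.symm g)).hom ≫ α.hom := fun g => by
    rw [hσ'_apply]; rfl
  let φ' : ℕ+ →* End A :=
    (α.conj.toMonoidHom.comp ((Ψ.functor.mapEnd A).comp φ)).comp ΨN.symm.toMonoidHom
  have hφ'_hom : ∀ n, End.asHom (φ' n) = α.inv ≫ Ψ.functor.map (End.asHom (φ (ΨN.symm n))) ≫ α.hom :=
    fun n => rfl
  -- its three properties
  have hσ' : ∀ g, (baseFunctor F).mapIso (σ' g) = g := fun g => by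
    rw [hσ'_apply, hθ, hσ, MulEquiv.apply_symm_apply]
  have hφ' : ∀ n : ℕ+, degFr F (End.asHom (φ' n)) = n ∧ IsBaseIdentity F (End.asHom (φ' n)) ∧
      IsFrobeniusType F (End.asHom (φ' n)) := fun n => by
    refine ⟨?_, ?_, ?_⟩
    · rw [hφ'_hom, hdeg, (hφ _).1, MulEquiv.apply_symm_apply]
    · rw [hφ'_hom]; exact hbi _ (hφ _).2.1
    · rw [hφ'_hom]; exact hft _ (hφ _).2.2
  have hc' : ∀ (n : ℕ+) (g : Aut (baseObj F A)),
      (σ' g).hom ≫ End.asHom (φ' n) = End.asHom (φ' n) ≫ (σ' g).hom := fun n g => by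
    rw [hσ'_hom, hφ'_hom]
    simp only [Category.assoc, Iso.hom_inv_id_assoc]
    congr 1
    rw [← Ψ.functor.map_comp_assoc, ← Ψ.functor.map_comp_assoc, hc]
  -- Prop. 5.6 for the two section pairs
  obtain ⟨u, hu, hσu, -⟩ := sectionPairs_conjugate F hF hnorm hσ hσ' hφ hφ' hc hc'
  refine ⟨u, hu, fun g => ?_⟩
  have h := congrArg Iso.hom (hσu (θ g))
  rw [hσ'_apply, MulEquiv.symm_apply_apply, Iso.trans_hom, Iso.trans_hom, Iso.symm_hom, Functor.mapIso_hom,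
    Iso.trans_hom, Iso.trans_hom, Iso.symm_hom] at h
  exact h

end PreFrobenioid

end Literature.AlgebraicGeometry.Frobenioids

/-! ### At the assembled §5 data `ofBiKummerData`: the binder `hstrv` -/

namespace Literature.AnabelianGeometry.EtaleTheta

open Literature.AlgebraicGeometry.Frobenioids

namespace ThetaFrobenioid

universe u₀ v₀ u v w

variable {K : Type u₀} [Field K]
  {X : SemiGraphs.TemperedArithmeticGroup.{u₀} K} {D₀ : Type u₀} [Category.{v₀} D₀]
  {V : FrdIMonoidStub.{w}} {T₀ : RealifiedDivisorMonoids (D₀ := D₀) V} {D : Type u} [Category.{v} D]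
  {VD : FrdICatStub.{u, v, w} D} {S : BiKummerSetting X T₀ D VD}
  {pullFrac : ∀ {A A' : S.C} (_ : A' ⟶ A), S.biratUnits A → S.biratUnits A'}
  {lv N : ℕ+} {T : ThetaEnvData.{max v w} N} {θr : S.biratUnits S.Aodot} {Bl : S.C}
  {Pl : S.FractionPair θr Bl} {Rl : S.NthRoot θr Pl lv pullFrac}
  (h : ModelFrobenioid.Hypotheses S.tf.divisorMonoid S.tf.ratFnFunctor)
  (toB : ∀ A : S.C, S.biratUnits A →* S.tf.biratUnitsModel A) (Q : FrobenioidTheta.ThetaSubquotientStub.{w} D)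
  (odd_l : Odd (lv : ℕ)) (R : S.NthRoot Rl.root Rl.pair N pullFrac) (ιX : T.PiX ≃ₜ* X.Pi)
  (hopen : IsOpen ((S.galoisSurj R.AN.base R.αData.isGalois).ker : Set X.Pi)) (σ : Aut R.AN.base →* Aut R.AN)
  (K' : Type w) [Field K'] (constEmb : K'ˣ →* S.tf.biratUnitsModel R.BN)
  (constEmb_injective : Function.Injective constEmb)
  (hdivc : ∀ g : Aut R.BN.base,
    ModelFrobenioid.div ((σ ((BiKummerSetting.NthRoot.baseIso S R).conjAut.symm g)).hom ≫ R.pair.num) =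
      ModelFrobenioid.div R.pair.num)
  (hdivp : ∀ y : T.PiYdd,
    ModelFrobenioid.div ((σ (S.galoisSurj R.AN.base R.αData.isGalois (ιX y.1))).hom ≫ R.pair.den) =
      ModelFrobenioid.div R.pair.den)

/-- **`hstrv` at the assembled §5 data** ([EtTh] Thm. 4.4 (iv) at the `N`-th root, as consumed by
`cyclotomicRigidityPreserved_ofBiKummerData`): if `s^trv_N = σ` extends to a section pair `(σ, φ)` at `A_N` («arising from a
base-Frobenius pair of `A_N`», [FrdI] Prop. 5.6 — e.g. a restricted pair, `PreFrobenioid.IsRestrictedPair.sectionPair`), and `Ψ`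
has base shadow `θ` at `A_N` through `α` and carries base-identity
Frobenius-type endomorphisms of `A_N` to such (degrees moved by `Ψ^{ℕ≥1}`), then for some UNIT `e ∈ O^×(A_N)`:
`StrvTransport Ψ α e θ_B`, where `θ_B` is `θ` read on `Aut_D(B_N^bs)` through `Aut_D(A_N^bs) ⥲ Aut_D(B_N^bs)` (conjugation by
`(s^⊓_N)^bs`).  [cite: MochizukiEtTh2009, Thm 5.10 (ii) p.334 (PDF p.108); §5 p.330–331 (PDF pp.104–105)] -/
theorem exists_unit_strvTransport_ofBiKummerData
    (hσ : ∀ g : Aut R.AN.base, ModelFrobenioid.baseMap (σ g).hom = g.hom)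
    (φ : ℕ+ →* End R.AN)
    (hφ : ∀ n : ℕ+, PreFrobenioid.degFr S.F (End.asHom (φ n)) = n ∧
      PreFrobenioid.IsBaseIdentity S.F (End.asHom (φ n)) ∧ PreFrobenioid.IsFrobeniusType S.F (End.asHom (φ n)))
    (hc : ∀ (n : ℕ+) (g : Aut R.AN.base), (σ g).hom ≫ End.asHom (φ n) = End.asHom (φ n) ≫ (σ g).hom)
    (Ψ : S.C ≌ S.C)
    (α : Ψ.functor.obj (ofBiKummerData h toB Q odd_l R ιX hopen σ K' constEmb constEmb_injective hdivc hdivp).AN ≅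
      (ofBiKummerData h toB Q odd_l R ιX hopen σ K' constEmb constEmb_injective hdivc hdivp).AN)
    (θ : Aut R.AN.base ≃* Aut R.AN.base)
    (hθ : ∀ f : Aut R.AN, (PreFrobenioid.baseFunctor S.F).mapIso (α.symm ≪≫ Ψ.functor.mapIso f ≪≫ α) =
      θ ((PreFrobenioid.baseFunctor S.F).mapIso f))
    (ΨN : ℕ+ ≃* ℕ+)
    (hdeg : ∀ f : R.AN ⟶ R.AN, PreFrobenioid.degFr S.F (α.inv ≫ Ψ.functor.map f ≫ α.hom) = ΨN (PreFrobenioid.degFr S.F f))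
    (hbi : ∀ f : R.AN ⟶ R.AN, PreFrobenioid.IsBaseIdentity S.F f →
      PreFrobenioid.IsBaseIdentity S.F (α.inv ≫ Ψ.functor.map f ≫ α.hom))
    (hft : ∀ f : R.AN ⟶ R.AN, PreFrobenioid.IsFrobeniusType S.F f →
      PreFrobenioid.IsFrobeniusType S.F (α.inv ≫ Ψ.functor.map f ≫ α.hom)) :
    ∃ e ∈ (ofBiKummerData h toB Q odd_l R ιX hopen σ K' constEmb constEmb_injective hdivc hdivp).units
        (ofBiKummerData h toB Q odd_l R ιX hopen σ K' constEmb constEmb_injective hdivc hdivp).AN,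
      (ofBiKummerData h toB Q odd_l R ιX hopen σ K' constEmb constEmb_injective hdivc hdivp).StrvTransport Ψ α e
        (((ofBiKummerData h toB Q odd_l R ιX hopen σ K' constEmb constEmb_injective hdivc hdivp).autBaseIsoAB.symm.trans
          θ).trans (ofBiKummerData h toB Q odd_l R ιX hopen σ K' constEmb constEmb_injective hdivc hdivp).autBaseIsoAB) := by
  have hF : PreFrobenioid.IsFrobenioid S.F :=
    ModelFrobenioid.isFrobenioid (DivB := S.tf.divBNatTrans) h.isMonoidOn h.isDivisorial h.isMonoidOn_rat
      h.isGroupLike_rat h.isGraphConnected h.isTotallyEpimorphic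
  -- [FrdI] Def. 4.5 (i): the model Frobenioid is of Frobenius-normalized type (abc-iut-L1, hypothesis-free)
  have hnorm : PreFrobenioid.IsOfType (PreFrobenioid.IsFrobeniusNormalized S.F) :=
    ModelFrobenioid.isOfType_isFrobeniusNormalized (Φ := S.tf.divisorMonoid) (B := S.tf.ratFnFunctor)
      (DivB := S.tf.divBNatTrans)
  have hσ' : ∀ g : Aut R.AN.base, (PreFrobenioid.baseFunctor S.F).mapIso (σ g) = g :=
    fun g => Iso.ext (hσ g)
  obtain ⟨u, hu, hconj⟩ :=
    PreFrobenioid.exists_unit_conj_of_transportedSectionPair S.F hF hnorm (A := R.AN) hσ' hφ hc Ψ α θ hθ ΨN hdeg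
      hbi hft
  refine ⟨u.symm, ?_, ?_⟩
  · -- `u⁻¹ ∈ O^×(A_N)` (the units of the data are those of the model, `ofBiKummerData_pre = rfl`)
    have : u⁻¹ ∈ PreFrobenioid.unitsSubgroup S.F R.AN := Subgroup.inv_mem _ hu
    rwa [Aut.Aut_inv_def] at this
  · intro g
    -- `autBaseIsoAB.symm (θ_B g) = θ (autBaseIsoAB.symm g)`, `strv = σ` (by `rfl`)
    set abI := (ofBiKummerData h toB Q odd_l R ιX hopen σ K' constEmb constEmb_injective hdivc hdivp).autBaseIsoAB
      with habI
    have hy : abI.symm (((abI.symm.trans θ).trans abI) g) = θ (abI.symm g) := by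
      rw [MulEquiv.trans_apply, MulEquiv.trans_apply]
      exact abI.symm_apply_apply _
    rw [hy]
    have h1 := congrArg (· ≫ u.inv) (hconj (abI.symm g))
    simp only [Category.assoc, Iso.hom_inv_id, Category.comp_id] at h1
    exact h1

end ThetaFrobenioid

end Literature.AnabelianGeometry.EtaleTheta

end
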